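import Literature.NumberTheory.EllipticCurves.BSDAnalyticRankTunnellWaldspurgerLValuesProofs
import HarnessLib

/-!
# The finite formula for `L(E_D ⊗ χ̄, 1)` split by the Chinese remainder theorem `ℤ[i]/3M′ = ℤ[i]/M′ × ℤ[i]/3`:
# the inner sums over the `3`-division classes — STUB-PLAN piece P6, GENERIC CORE

Summit `BirchSwinnertonDyer`, crux `InertBadAtThree` (stmt-BirchSwinnertonDyer-19225), line of record `Lines/rubin_e1_inert_three.lean`
v5, registered stub `stub_plainOddNeronIntegralThreeQuartic`; STUB-PLAN `Cruxes/InertBadAtThree/STUB-PLAN-neronIntegralThreeQuartic-bsd-idea-18-g8.md`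
piece **P6 `stub_clean_of_dictionary`** (the CRT split of the finite formula + valuation bookkeeping). Width seat bsd-wall-cm-bed-w3 g8
(`--supports 19225`, helper). This file is the GENERIC, character-free core of P6 — valid for ANY coefficient `Ψ = Φ·Ψ′` with `Φ` periodic
modulo `3` and `Ψ′` periodic modulo `M′`, `gcd(M′, 3) = 1` (P1b's output shape: `Φ = χ̄₄^k`, `Ψ′` the tame part) — written on the template of
the tree's `n = 3` computation `sum_heckePsi_three_crt` / `sum_normJacobi_kroneckerE₁` (`BSDAnalyticRankTunnellWaldspurgerLValuesProofs`, the
case `M′ = 4`, `Φ = κ = (N·/3)`):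

* `sum_classes_crt` — for `3e − M′f = 1`:
  `Σ_{c mod 3M′} Ψ′(c)Φ(c)·E₁*(c̄/(3M′)) = Σ_{a mod M′} Ψ′(a) · Σ_{b mod 3} Φ(b)·E₁*(e·ā/M′ − f·b̄/3)`
  (`c ↔ (a, b)` by `crtPairEquiv`; `c̄/3M′ ≡ eā/M′ − fb̄/3 (mod Λ)` because `c = 3e·c − M′f·c`; `E₁*` is `Λ`-periodic).
* `sum_three_classes_kroneckerE₁` — for `Φ` periodic modulo `3` and EVEN (`Φ(−x) = Φ(x)`) and any `f` with `3 ∤ f`, the inner sum is the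
  explicit combination over the eight non-zero `3`-division points:
  `Σ_{b mod 3} Φ(b)E₁*(w − f b̄/3) = Φ(0)E₁*(w) + Φ(1)[E₁*(w ± 1/3)] + Φ(i)[E₁*(w ± i/3)] + Φ(1+i)[E₁*(w ± (1−i)/3)] + Φ(1−i)[E₁*(w ± (1+i)/3)]`
  — complex conjugation SWAPS the two diagonal classes (memo EPSILON-RESOLVED §4 / plan §4: this is why `Φ = χ̄₄` meets the `χ₄`-form). For
  `Φ = χ̄₄` (values `1, −1, i, −i` at `1, i, 1+i, 1−i`) the bracket is VERBATIM the left side of bed-w1's `quarticSum_eq` (p628575), for `Φ = χ₄`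
  that of `quarticConjSum_eq`, for `Φ = κ` the tree's `threeTorsionTwistedSum`.
* `thetaLFunction_one_crt` — with the finite formula `GaussianLattice.thetaLFunction_one_eq_sum_kroneckerE₁`:
  `Θ-L_{3M′}(Φ·Ψ′)(1) = (3M′)⁻¹ Σ_{a mod M′} Ψ′(a) Σ_{b mod 3} Φ(b)E₁*(e·ā/M′ − f·b̄/3)`, and `thetaLFunction_one_crt_even` with the inner sum
  expanded as above.

HONEST FRAMING: pure bookkeeping on the Gaussian lattice; nothing here proves the stub, the crux or BSD. No definition, no named fact, no
`sorry`; axioms standard.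
-/

set_option autoImplicit false
set_option linter.dupNamespace false

noncomputable section

open UpperHalfPlane hiding I
open Complex Real PeriodPair
open Literature.NumberTheory.LFunctions.GaussianTheta
open Literature.NumberTheory.EllipticCurves Literature.NumberTheory.EllipticCurves.GaussianLattice
open scoped ComplexConjugate

namespace Summit.BirchSwinnertonDyer.BirchSwinnertonDyer.Theorems.InertBadSignedBranchesInertBadAtThreeQuarticFiniteFormulaCRT

/-! ## §1 The CRT split of a class sum modulo `3M′` -/

section CRT

variable (M' : ℕ) [NeZero M'] [NeZero (M' * 3)]

/-- ★ **CRT split.** For `gcd(M′, 3) = 1`, `Ψ′` periodic modulo `M′`, `Φ` periodic modulo `3`, and integers `e, f` with `3e − M′f = 1`: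
`Σ_{c mod 3M′} Ψ′(c)Φ(c)E₁*(conj(c/(3M′))) = Σ_{a mod M′} Ψ′(a) Σ_{b mod 3} Φ(b) E₁*(e·conj(a)/M′ − f·conj(b)/3)` (canonical representatives;
`c ↔ (c mod M′, c mod 3)`, `c = 3e·c − M′f·c`, `E₁*` is `ℤi + ℤ`-periodic). [folklore] -/
theorem sum_classes_crt (hc : M'.Coprime 3) {Ψ' Φ : GaussianInt → ℂ}
    (hΨ : ∀ x y : GaussianInt, Ψ' (x + M' * y) = Ψ' x) (hΦ : ∀ x y : GaussianInt, Φ (x + 3 * y) = Φ x)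
    {e f : ℤ} (hef : 3 * e - M' * f = 1) :
    ∑ c : ZMod (M' * 3) × ZMod (M' * 3),
        Ψ' (rep (M' * 3) c 0) * Φ (rep (M' * 3) c 0) * kroneckerE₁ (conj (classDiv (M' * 3) c)) =
      ∑ a : ZMod M' × ZMod M', Ψ' (rep M' a 0) *
        ∑ b : ZMod 3 × ZMod 3, Φ (rep 3 b 0) *
          kroneckerE₁ (e * conj ((rep M' a 0 : GaussianInt) : ℂ) / M' - f * conj ((rep 3 b 0 : GaussianInt) : ℂ) / 3) := by
  have hM0 : (M' : ℂ) ≠ 0 := Nat.cast_ne_zero.mpr (NeZero.ne M')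
  calc ∑ c : ZMod (M' * 3) × ZMod (M' * 3),
        Ψ' (rep (M' * 3) c 0) * Φ (rep (M' * 3) c 0) * kroneckerE₁ (conj (classDiv (M' * 3) c))
      = ∑ p : (ZMod M' × ZMod M') × (ZMod 3 × ZMod 3), Ψ' (rep M' p.1 0) *
          (Φ (rep 3 p.2 0) * kroneckerE₁ (e * conj ((rep M' p.1 0 : GaussianInt) : ℂ) / M' -
            f * conj ((rep 3 p.2 0 : GaussianInt) : ℂ) / 3)) := by
        refine Fintype.sum_equiv (crtPairEquiv hc) _ _ fun c ↦ ?_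
        rw [crtPairEquiv_apply_fst, crtPairEquiv_apply_snd]
        set x : GaussianInt := rep (M' * 3) c 0 with hxdef
        set a : ZMod M' × ZMod M' := ((c.1.val : ZMod M'), (c.2.val : ZMod M')) with hadef
        set b : ZMod 3 × ZMod 3 := ((c.1.val : ZMod 3), (c.2.val : ZMod 3)) with hbdef
        have hclsa : cls M' x = a := by simp [cls, rep, hxdef, hadef]
        have hclsb : cls 3 x = b := by simp [cls, rep, hxdef, hbdef]
        have e1 : Ψ' x = Ψ' (rep M' a 0) := apply_eq_of_cls_eq M' hΨ (by rw [hclsa, cls_rep])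
        have e2 : Φ x = Φ (rep 3 b 0) := apply_eq_of_cls_eq 3 hΦ (by rw [hclsb, cls_rep])
        obtain ⟨y₁, hy₁⟩ := exists_rep_eq M' hclsa
        obtain ⟨y₂, hy₂⟩ := exists_rep_eq 3 hclsb
        have hxA : (x : ℂ) = (rep M' a 0 : ℂ) + M' * ((⟨y₁.1, y₁.2⟩ : GaussianInt) : ℂ) := by
          rw [← hy₁, rep_eq_rep_zero_add M' a y₁, GaussianInt.toComplex_add, GaussianInt.toComplex_mul, map_natCast]
        have hxB : (x : ℂ) = (rep 3 b 0 : ℂ) + 3 * ((⟨y₂.1, y₂.2⟩ : GaussianInt) : ℂ) := by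
          rw [← hy₂, rep_eq_rep_zero_add 3 b y₂, GaussianInt.toComplex_add, GaussianInt.toComplex_mul, map_natCast]
          push_cast
          ring
        have hef' : (3 : ℂ) * e - M' * f = 1 := by exact_mod_cast hef
        have hx : (x : ℂ) = 3 * e * ((rep M' a 0 : ℂ) + M' * ((⟨y₁.1, y₁.2⟩ : GaussianInt) : ℂ)) -
            M' * f * ((rep 3 b 0 : ℂ) + 3 * ((⟨y₂.1, y₂.2⟩ : GaussianInt) : ℂ)) := by
          rw [← hxA, ← hxB]; linear_combination -((x : ℂ)) * hef'
        have e3 : kroneckerE₁ (conj (classDiv (M' * 3) c)) =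
            kroneckerE₁ (e * conj ((rep M' a 0 : GaussianInt) : ℂ) / M' - f * conj ((rep 3 b 0 : GaussianInt) : ℂ) / 3) := by
          have hl := (ofUpperHalfPlane UpperHalfPlane.I).lattice.sub_mem
            ((ofUpperHalfPlane UpperHalfPlane.I).lattice.smul_mem e (conj_toComplex_mem_lattice ⟨y₁.1, y₁.2⟩))
            ((ofUpperHalfPlane UpperHalfPlane.I).lattice.smul_mem f (conj_toComplex_mem_lattice ⟨y₂.1, y₂.2⟩))
          rw [classDiv_def, ← hxdef, map_div₀, map_natCast, hx,
            show conj (3 * e * (((rep M' a 0 : GaussianInt) : ℂ) + M' * ((⟨y₁.1, y₁.2⟩ : GaussianInt) : ℂ)) -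
                M' * f * (((rep 3 b 0 : GaussianInt) : ℂ) + 3 * ((⟨y₂.1, y₂.2⟩ : GaussianInt) : ℂ))) / ((M' * 3 : ℕ) : ℂ) =
              (e * conj ((rep M' a 0 : GaussianInt) : ℂ) / M' - f * conj ((rep 3 b 0 : GaussianInt) : ℂ) / 3) +
                (e • conj (((⟨y₁.1, y₁.2⟩ : GaussianInt) : ℂ)) - f • conj (((⟨y₂.1, y₂.2⟩ : GaussianInt) : ℂ))) by
              simp only [map_sub, map_add, map_mul, map_ofNat, map_natCast, map_intCast, zsmul_eq_mul]
              push_cast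
              field_simp
              ring,
            kroneckerE₁_add_of_mem _ hl]
        rw [e1, e2, e3]
        ring
    _ = _ := by
        rw [Fintype.sum_prod_type]
        refine Finset.sum_congr rfl fun a _ ↦ ?_
        rw [Finset.mul_sum]

end CRT

/-! ## §2 The inner sum over the classes modulo `3` -/

section Inner

/-- `E₁*(z − f·β/3) = E₁*(z − r·β/3)` for `f ≡ r (mod 3)` and `β` the conjugate of a Gaussian integer (`E₁*` is `Λ`-periodic). [folklore] -/
theorem kroneckerE₁_sub_int_mul_conj_div_three (z : ℂ) (x : GaussianInt) {f r : ℤ} (h : f % 3 = r) :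
    kroneckerE₁ (z - f * conj ((x : GaussianInt) : ℂ) / 3) = kroneckerE₁ (z - r * conj ((x : GaussianInt) : ℂ) / 3) := by
  have hf : (f : ℂ) = 3 * (f / 3 : ℤ) + r := by
    have : f = 3 * (f / 3) + f % 3 := by omega
    rw [← h]; exact_mod_cast this
  have hl := (ofUpperHalfPlane UpperHalfPlane.I).lattice.smul_mem (-(f / 3) : ℤ) (conj_toComplex_mem_lattice x)
  rw [show z - f * conj ((x : GaussianInt) : ℂ) / 3 = (z - r * conj ((x : GaussianInt) : ℂ) / 3) +
      (-(f / 3) : ℤ) • conj ((x : GaussianInt) : ℂ) by rw [hf, zsmul_eq_mul]; push_cast; ring,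
    kroneckerE₁_add_of_mem _ hl]

/-- The values of a `3`-periodic even coefficient on the nine canonical representatives modulo `3` in terms of its values at
`0, 1, i, 1+i, 1−i`. [folklore] -/
theorem three_periodic_even_values {Φ : GaussianInt → ℂ} (hΦ : ∀ x y : GaussianInt, Φ (x + 3 * y) = Φ x)
    (heven : ∀ x : GaussianInt, Φ (-x) = Φ x) :
    Φ ⟨2, 0⟩ = Φ 1 ∧ Φ ⟨0, 2⟩ = Φ ⟨0, 1⟩ ∧ Φ ⟨2, 2⟩ = Φ ⟨1, 1⟩ ∧ Φ ⟨1, 2⟩ = Φ ⟨1, -1⟩ ∧ Φ ⟨2, 1⟩ = Φ ⟨1, -1⟩ ∧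
      Φ ⟨1, 0⟩ = Φ 1 ∧ Φ ⟨0, 0⟩ = Φ 0 := by
  refine ⟨?_, ?_, ?_, ?_, ?_, rfl, rfl⟩
  · rw [show (⟨2, 0⟩ : GaussianInt) = -⟨1, 0⟩ + 3 * ⟨1, 0⟩ by ext <;> simp, hΦ, heven]; rfl
  · rw [show (⟨0, 2⟩ : GaussianInt) = -⟨0, 1⟩ + 3 * ⟨0, 1⟩ by ext <;> simp, hΦ, heven]
  · rw [show (⟨2, 2⟩ : GaussianInt) = -⟨1, 1⟩ + 3 * ⟨1, 1⟩ by ext <;> simp, hΦ, heven]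
  · rw [show (⟨1, 2⟩ : GaussianInt) = ⟨1, -1⟩ + 3 * ⟨0, 1⟩ by ext <;> simp, hΦ]
  · rw [show (⟨2, 1⟩ : GaussianInt) = -⟨1, -1⟩ + 3 * ⟨1, 0⟩ by ext <;> simp, hΦ, heven]

/-- The inner sum for the multiplier `1`: `Σ_{b mod 3} Φ(b)E₁*(w − b̄/3)` over the eight non-zero `3`-division points (`Φ` periodic
modulo `3` and even; conjugation swaps the two diagonal classes). [folklore] -/
theorem sum_three_classes_kroneckerE₁_one {Φ : GaussianInt → ℂ} (hΦ : ∀ x y : GaussianInt, Φ (x + 3 * y) = Φ x)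
    (heven : ∀ x : GaussianInt, Φ (-x) = Φ x) (w : ℂ) :
    ∑ b : ZMod 3 × ZMod 3, Φ (rep 3 b 0) * kroneckerE₁ (w - conj ((rep 3 b 0 : GaussianInt) : ℂ) / 3) =
      Φ 0 * kroneckerE₁ w +
        Φ 1 * (kroneckerE₁ (w + 1 / 3) + kroneckerE₁ (w - 1 / 3)) +
        Φ ⟨0, 1⟩ * (kroneckerE₁ (w + I / 3) + kroneckerE₁ (w - I / 3)) +
        Φ ⟨1, 1⟩ * (kroneckerE₁ (w + (1 - I) / 3) + kroneckerE₁ (w - (1 - I) / 3)) +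
        Φ ⟨1, -1⟩ * (kroneckerE₁ (w + (1 + I) / 3) + kroneckerE₁ (w - (1 + I) / 3)) := by
  obtain ⟨p20, p02, p22, p12, p21, p10, p00⟩ := three_periodic_even_values hΦ heven
  have neg_one_add_I_mem : (-1 + I : ℂ) ∈ (ofUpperHalfPlane UpperHalfPlane.I).lattice :=
    mem_lattice_iff.mpr ⟨1, -1, by push_cast; ring⟩
  have f2 : kroneckerE₁ (w - 2 / 3) = kroneckerE₁ (w + 1 / 3) := by
    rw [show w - 2 / 3 = (w + 1 / 3) + -1 by ring,
      kroneckerE₁_add_of_mem _ ((ofUpperHalfPlane UpperHalfPlane.I).lattice.neg_mem one_mem)]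
  have f4 : kroneckerE₁ (w + 2 * I / 3) = kroneckerE₁ (w - I / 3) := by
    rw [show w + 2 * I / 3 = (w - I / 3) + I by ring, kroneckerE₁_add_of_mem _ I_mem]
  have f6 : kroneckerE₁ (w - (2 - 2 * I) / 3) = kroneckerE₁ (w + (1 - I) / 3) := by
    rw [show w - (2 - 2 * I) / 3 = (w + (1 - I) / 3) + -(1 - I) by ring,
      kroneckerE₁_add_of_mem _ ((ofUpperHalfPlane UpperHalfPlane.I).lattice.neg_mem one_sub_I_mem)]
  have f7 : kroneckerE₁ (w - (1 - 2 * I) / 3) = kroneckerE₁ (w - (1 + I) / 3) := by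
    rw [show w - (1 - 2 * I) / 3 = (w - (1 + I) / 3) + I by ring, kroneckerE₁_add_of_mem _ I_mem]
  have f8 : kroneckerE₁ (w - (2 - I) / 3) = kroneckerE₁ (w + (1 + I) / 3) := by
    rw [show w - (2 - I) / 3 = (w + (1 + I) / 3) + -1 by ring,
      kroneckerE₁_add_of_mem _ ((ofUpperHalfPlane UpperHalfPlane.I).lattice.neg_mem one_mem)]
  rw [Fintype.sum_prod_type, sum_univ_zmod_three]
  simp only [sum_univ_zmod_three, rep_three_zero]
  have hv : ((0 : ZMod 3).val : ℤ) = 0 ∧ ((1 : ZMod 3).val : ℤ) = 1 ∧ ((2 : ZMod 3).val : ℤ) = 2 := by decide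
  obtain ⟨h0, h1, h2⟩ := hv
  simp only [h0, h1, h2, p20, p02, p22, p12, p21, p10, p00, GaussianInt.toComplex_def']
  push_cast
  simp only [map_add, map_mul, map_zero, map_one, map_ofNat, Complex.conj_I]
  ring_nf
  ring_nf at f2 f4 f6 f7 f8
  rw [f2, f4, f6, f7, f8]
  ring

/-- The inner sum for the multiplier `2` (`−2b̄/3 ≡ b̄/3 (mod Λ)`): the same combination. [folklore] -/
theorem sum_three_classes_kroneckerE₁_two {Φ : GaussianInt → ℂ} (hΦ : ∀ x y : GaussianInt, Φ (x + 3 * y) = Φ x)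
    (heven : ∀ x : GaussianInt, Φ (-x) = Φ x) (w : ℂ) :
    ∑ b : ZMod 3 × ZMod 3, Φ (rep 3 b 0) * kroneckerE₁ (w - 2 * conj ((rep 3 b 0 : GaussianInt) : ℂ) / 3) =
      Φ 0 * kroneckerE₁ w +
        Φ 1 * (kroneckerE₁ (w + 1 / 3) + kroneckerE₁ (w - 1 / 3)) +
        Φ ⟨0, 1⟩ * (kroneckerE₁ (w + I / 3) + kroneckerE₁ (w - I / 3)) +
        Φ ⟨1, 1⟩ * (kroneckerE₁ (w + (1 - I) / 3) + kroneckerE₁ (w - (1 - I) / 3)) +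
        Φ ⟨1, -1⟩ * (kroneckerE₁ (w + (1 + I) / 3) + kroneckerE₁ (w - (1 + I) / 3)) := by
  obtain ⟨p20, p02, p22, p12, p21, p10, p00⟩ := three_periodic_even_values hΦ heven
  have neg_one_add_I_mem : (-1 + I : ℂ) ∈ (ofUpperHalfPlane UpperHalfPlane.I).lattice :=
    mem_lattice_iff.mpr ⟨1, -1, by push_cast; ring⟩
  have f1 : kroneckerE₁ (w - 2 / 3) = kroneckerE₁ (w + 1 / 3) := by
    rw [show w - 2 / 3 = (w + 1 / 3) + -1 by ring,
      kroneckerE₁_add_of_mem _ ((ofUpperHalfPlane UpperHalfPlane.I).lattice.neg_mem one_mem)]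
  have f2 : kroneckerE₁ (w - 4 / 3) = kroneckerE₁ (w - 1 / 3) := by
    rw [show w - 4 / 3 = (w - 1 / 3) + -1 by ring,
      kroneckerE₁_add_of_mem _ ((ofUpperHalfPlane UpperHalfPlane.I).lattice.neg_mem one_mem)]
  have f3 : kroneckerE₁ (w + 2 * I / 3) = kroneckerE₁ (w - I / 3) := by
    rw [show w + 2 * I / 3 = (w - I / 3) + I by ring, kroneckerE₁_add_of_mem _ I_mem]
  have f4 : kroneckerE₁ (w + 4 * I / 3) = kroneckerE₁ (w + I / 3) := by
    rw [show w + 4 * I / 3 = (w + I / 3) + I by ring, kroneckerE₁_add_of_mem _ I_mem]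
  have f5 : kroneckerE₁ (w - 2 * (1 - I) / 3) = kroneckerE₁ (w + (1 - I) / 3) := by
    rw [show w - 2 * (1 - I) / 3 = (w + (1 - I) / 3) + -(1 - I) by ring,
      kroneckerE₁_add_of_mem _ ((ofUpperHalfPlane UpperHalfPlane.I).lattice.neg_mem one_sub_I_mem)]
  have f6 : kroneckerE₁ (w - 2 * (2 - 2 * I) / 3) = kroneckerE₁ (w - (1 - I) / 3) := by
    rw [show w - 2 * (2 - 2 * I) / 3 = (w - (1 - I) / 3) + -(1 - I) by ring,
      kroneckerE₁_add_of_mem _ ((ofUpperHalfPlane UpperHalfPlane.I).lattice.neg_mem one_sub_I_mem)]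
  have f7 : kroneckerE₁ (w - 2 * (1 - 2 * I) / 3) = kroneckerE₁ (w + (1 + I) / 3) := by
    rw [show w - 2 * (1 - 2 * I) / 3 = (w + (1 + I) / 3) + (-1 + I) by ring,
      kroneckerE₁_add_of_mem _ neg_one_add_I_mem]
  have f8 : kroneckerE₁ (w - 2 * (2 - I) / 3) = kroneckerE₁ (w - (1 + I) / 3) := by
    rw [show w - 2 * (2 - I) / 3 = (w - (1 + I) / 3) + (-1 + I) by ring,
      kroneckerE₁_add_of_mem _ neg_one_add_I_mem]
  rw [Fintype.sum_prod_type, sum_univ_zmod_three]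
  simp only [sum_univ_zmod_three, rep_three_zero]
  have hv : ((0 : ZMod 3).val : ℤ) = 0 ∧ ((1 : ZMod 3).val : ℤ) = 1 ∧ ((2 : ZMod 3).val : ℤ) = 2 := by decide
  obtain ⟨h0, h1, h2⟩ := hv
  simp only [h0, h1, h2, p20, p02, p22, p12, p21, p10, p00, GaussianInt.toComplex_def']
  push_cast
  simp only [map_add, map_mul, map_zero, map_one, map_ofNat, Complex.conj_I]
  ring_nf
  ring_nf at f1 f2 f3 f4 f5 f6 f7 f8
  rw [f1, f2, f3, f4, f5, f6, f7, f8]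
  ring

/-- ★ **The inner sum over `ℤ[i]/3` as a sum over the eight non-zero `3`-division points.** For `Φ` periodic modulo `3` and even, and
`3 ∤ f`: `Σ_{b mod 3} Φ(b)E₁*(w − f·b̄/3) = Φ(0)E₁*(w) + Φ(1)[E₁*(w+1/3)+E₁*(w−1/3)] + Φ(i)[E₁*(w+i/3)+E₁*(w−i/3)]
+ Φ(1+i)[E₁*(w+(1−i)/3)+E₁*(w−(1−i)/3)] + Φ(1−i)[E₁*(w+(1+i)/3)+E₁*(w−(1+i)/3)]` (conjugation swaps the diagonal classes). [folklore] -/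
theorem sum_three_classes_kroneckerE₁ {Φ : GaussianInt → ℂ} (hΦ : ∀ x y : GaussianInt, Φ (x + 3 * y) = Φ x)
    (heven : ∀ x : GaussianInt, Φ (-x) = Φ x) {f : ℤ} (hf : ¬ (3 : ℤ) ∣ f) (w : ℂ) :
    ∑ b : ZMod 3 × ZMod 3, Φ (rep 3 b 0) * kroneckerE₁ (w - f * conj ((rep 3 b 0 : GaussianInt) : ℂ) / 3) =
      Φ 0 * kroneckerE₁ w +
        Φ 1 * (kroneckerE₁ (w + 1 / 3) + kroneckerE₁ (w - 1 / 3)) +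
        Φ ⟨0, 1⟩ * (kroneckerE₁ (w + I / 3) + kroneckerE₁ (w - I / 3)) +
        Φ ⟨1, 1⟩ * (kroneckerE₁ (w + (1 - I) / 3) + kroneckerE₁ (w - (1 - I) / 3)) +
        Φ ⟨1, -1⟩ * (kroneckerE₁ (w + (1 + I) / 3) + kroneckerE₁ (w - (1 + I) / 3)) := by
  have hr : f % 3 = 1 ∨ f % 3 = 2 := by omega
  rcases hr with hr | hr
  · have hred : ∀ b : ZMod 3 × ZMod 3, kroneckerE₁ (w - f * conj ((rep 3 b 0 : GaussianInt) : ℂ) / 3) =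
        kroneckerE₁ (w - conj ((rep 3 b 0 : GaussianInt) : ℂ) / 3) := fun b ↦ by
      rw [kroneckerE₁_sub_int_mul_conj_div_three w _ hr]; push_cast; rw [one_mul]
    simp_rw [hred]
    exact sum_three_classes_kroneckerE₁_one hΦ heven w
  · have hred : ∀ b : ZMod 3 × ZMod 3, kroneckerE₁ (w - f * conj ((rep 3 b 0 : GaussianInt) : ℂ) / 3) =
        kroneckerE₁ (w - 2 * conj ((rep 3 b 0 : GaussianInt) : ℂ) / 3) := fun b ↦ by
      rw [kroneckerE₁_sub_int_mul_conj_div_three w _ hr]; push_cast; rfl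
    simp_rw [hred]
    exact sum_three_classes_kroneckerE₁_two hΦ heven w

end Inner

/-! ## §3 The finite formula, split -/

section FiniteFormula

variable (M' : ℕ) [NeZero M'] [NeZero (M' * 3)]

omit [NeZero M'] [NeZero (M' * 3)] in
/-- Bézout for `gcd(M′, 3) = 1`: integers `e, f` with `3e − M′f = 1`. [folklore] -/
theorem exists_three_mul_sub_mul_eq_one (hc : M'.Coprime 3) : ∃ e f : ℤ, 3 * e - M' * f = 1 := by
  obtain ⟨a, b, hab⟩ := (Nat.isCoprime_iff_coprime.mpr hc.symm : IsCoprime ((3 : ℕ) : ℤ) (M' : ℤ))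
  refine ⟨a, -b, ?_⟩
  push_cast at hab
  linear_combination hab

omit [NeZero M'] [NeZero (M' * 3)] in
/-- `3e − M′f = 1 ⇒ 3 ∤ f`. [folklore] -/
theorem not_three_dvd_of_bezout {e f : ℤ} (hef : 3 * e - M' * f = 1) : ¬ (3 : ℤ) ∣ f := by
  rintro ⟨k, rfl⟩
  have h3 : (3 : ℤ) ∣ 1 := ⟨e - M' * k, by linear_combination -hef⟩
  norm_num at h3

omit [NeZero M'] [NeZero (M' * 3)] in
/-- A product of an `M′`-periodic and a `3`-periodic coefficient is `3M′`-periodic. [folklore] -/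
theorem periodic_mul {Ψ' Φ : GaussianInt → ℂ}
    (hΨ : ∀ x y : GaussianInt, Ψ' (x + M' * y) = Ψ' x) (hΦ : ∀ x y : GaussianInt, Φ (x + 3 * y) = Φ x) :
    ∀ x y : GaussianInt, Ψ' (x + ((M' * 3 : ℕ) : GaussianInt) * y) * Φ (x + ((M' * 3 : ℕ) : GaussianInt) * y) = Ψ' x * Φ x := by
  intro x y
  rw [show x + ((M' * 3 : ℕ) : GaussianInt) * y = x + (M' : GaussianInt) * (3 * y) by push_cast; ring, hΨ,
    show x + (M' : GaussianInt) * (3 * y) = x + 3 * ((M' : GaussianInt) * y) by ring, hΦ]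

/-- ★ **The finite formula split by CRT**: for `Ψ = Ψ′·Φ` (`Ψ′` periodic mod `M′`, `Φ` periodic mod `3`, `gcd(M′,3) = 1`, `3e − M′f = 1`),
`Θ-L_{3M′}(Ψ)(1) = (3M′)⁻¹ Σ_{a mod M′} Ψ′(a) Σ_{b mod 3} Φ(b) E₁*(e·ā/M′ − f·b̄/3)`
(`GaussianLattice.thetaLFunction_one_eq_sum_kroneckerE₁` + `sum_classes_crt`). [cite: Rubin1999, Prop. 7.15] -/
theorem thetaLFunction_one_crt (hc : M'.Coprime 3) {Ψ' Φ : GaussianInt → ℂ}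
    (hΨ : ∀ x y : GaussianInt, Ψ' (x + M' * y) = Ψ' x) (hΦ : ∀ x y : GaussianInt, Φ (x + 3 * y) = Φ x)
    {e f : ℤ} (hef : 3 * e - M' * f = 1) :
    thetaLFunction (M' * 3) (fun x ↦ Ψ' x * Φ x) 1 =
      ((M' * 3 : ℕ) : ℂ)⁻¹ * ∑ a : ZMod M' × ZMod M', Ψ' (rep M' a 0) *
        ∑ b : ZMod 3 × ZMod 3, Φ (rep 3 b 0) *
          kroneckerE₁ (e * conj ((rep M' a 0 : GaussianInt) : ℂ) / M' - f * conj ((rep 3 b 0 : GaussianInt) : ℂ) / 3) := by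
  rw [GaussianLattice.thetaLFunction_one_eq_sum_kroneckerE₁ (M' * 3) (fun x ↦ Ψ' x * Φ x) (periodic_mul M' hΨ hΦ),
    ← sum_classes_crt M' hc hΨ hΦ hef]

/-- ★ **The finite formula split by CRT, inner sums expanded** (`Φ` even): `Θ-L_{3M′}(Ψ′Φ)(1) = (3M′)⁻¹ Σ_{a mod M′} Ψ′(a)·T_Φ(e·ā/M′)` with
`T_Φ(w) = Φ(0)E₁*(w) + Φ(1)[E₁*(w ± 1/3)] + Φ(i)[E₁*(w ± i/3)] + Φ(1+i)[E₁*(w ± (1−i)/3)] + Φ(1−i)[E₁*(w ± (1+i)/3)]` — for `Φ = χ̄₄`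
(resp. `χ₄`, `κ`) the bracket of bed-w1's `quarticSum_eq` (resp. `quarticConjSum_eq`, the tree's `threeTorsionTwistedSum`) at `w = e·ā/M′`,
a point with `M′·w ∈ ℤi + ℤ`. [cite: Rubin1999, Prop. 7.15] -/
theorem thetaLFunction_one_crt_even (hc : M'.Coprime 3) {Ψ' Φ : GaussianInt → ℂ}
    (hΨ : ∀ x y : GaussianInt, Ψ' (x + M' * y) = Ψ' x) (hΦ : ∀ x y : GaussianInt, Φ (x + 3 * y) = Φ x)
    (heven : ∀ x : GaussianInt, Φ (-x) = Φ x) {e f : ℤ} (hef : 3 * e - M' * f = 1) :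
    thetaLFunction (M' * 3) (fun x ↦ Ψ' x * Φ x) 1 =
      ((M' * 3 : ℕ) : ℂ)⁻¹ * ∑ a : ZMod M' × ZMod M', Ψ' (rep M' a 0) *
        (Φ 0 * kroneckerE₁ (e * conj ((rep M' a 0 : GaussianInt) : ℂ) / M') +
          Φ 1 * (kroneckerE₁ (e * conj ((rep M' a 0 : GaussianInt) : ℂ) / M' + 1 / 3) +
            kroneckerE₁ (e * conj ((rep M' a 0 : GaussianInt) : ℂ) / M' - 1 / 3)) +
          Φ ⟨0, 1⟩ * (kroneckerE₁ (e * conj ((rep M' a 0 : GaussianInt) : ℂ) / M' + I / 3) +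
            kroneckerE₁ (e * conj ((rep M' a 0 : GaussianInt) : ℂ) / M' - I / 3)) +
          Φ ⟨1, 1⟩ * (kroneckerE₁ (e * conj ((rep M' a 0 : GaussianInt) : ℂ) / M' + (1 - I) / 3) +
            kroneckerE₁ (e * conj ((rep M' a 0 : GaussianInt) : ℂ) / M' - (1 - I) / 3)) +
          Φ ⟨1, -1⟩ * (kroneckerE₁ (e * conj ((rep M' a 0 : GaussianInt) : ℂ) / M' + (1 + I) / 3) +
            kroneckerE₁ (e * conj ((rep M' a 0 : GaussianInt) : ℂ) / M' - (1 + I) / 3))) := by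
  rw [thetaLFunction_one_crt M' hc hΨ hΦ hef]
  congr 1
  refine Finset.sum_congr rfl fun a _ ↦ ?_
  rw [sum_three_classes_kroneckerE₁ hΦ heven (not_three_dvd_of_bezout M' hef)]

omit [NeZero (M' * 3)] in
/-- The base points `w_a = e·ā/M′` are `M′`-division points of `ℤi + ℤ`: `M′·w_a ∈ Λ`. [folklore] -/
theorem natCast_mul_basePoint_mem (e : ℤ) (a : ZMod M' × ZMod M') :
    (M' : ℂ) * (e * conj ((rep M' a 0 : GaussianInt) : ℂ) / M') ∈ (ofUpperHalfPlane UpperHalfPlane.I).lattice := by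
  have hM0 : (M' : ℂ) ≠ 0 := Nat.cast_ne_zero.mpr (NeZero.ne M')
  rw [show (M' : ℂ) * (e * conj ((rep M' a 0 : GaussianInt) : ℂ) / M') = e • conj ((rep M' a 0 : GaussianInt) : ℂ) by
    rw [zsmul_eq_mul]; field_simp]
  exact (ofUpperHalfPlane UpperHalfPlane.I).lattice.smul_mem e (conj_toComplex_mem_lattice _)

end FiniteFormula

end Summit.BirchSwinnertonDyer.BirchSwinnertonDyer.Theorems.InertBadSignedBranchesInertBadAtThreeQuarticFiniteFormulaCRT

end
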